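import Summits.HodgeConjecture.HodgeCM.PerL34.GenuineSchrodingerSchwartzDense_1

/-! PORT of `HodgeCM/PerL34/GenuineSchrodingerSchwartzDense.lean` (HodgeCMPerL run 82) — part 2: continuation of `Summits.HodgeConjecture.HodgeCM.PerL34.GenuineSchrodingerSchwartzDense_1` (split at a top-level declaration boundary by port_pkg.py; scope re-opened below; declarations unchanged). -/

-- port_pkg: scope re-opened for this part (file-level context, then the namespace/section stack open at the cut)
set_option autoImplicit false
noncomputable section
open MeasureTheory MeasureTheory.Measure Set Metric Function Complex Topology Filter
open scoped RestrictedProduct InnerProductSpace NNReal ENNReal Pointwise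
namespace HodgeCM.PerL34.PureTensor.SchrodingerModel
open HodgeCM.PerL34.LocalFactors HodgeCM.PerL34.LocalFactors.DilationModel
open HodgeCM.PerL34.LocalFactors.SchrodingerLevi
open HodgeCM.PerL34.IdelePlaces HodgeCM.PerL34.IdelicTorusModel HodgeCM.PerL34.IdelicTorusModel.Genuine
open NumberField IsDedekindDomain
attribute [local instance] LocalFactors.DilationModel.Adic.nontriviallyNormedField
  LocalFactors.DilationModel.Adic.properSpace
variable {L : Type} [Field L] [NumberField L] [IsCMField L]
namespace Coeff
/-- **the whole Heisenberg–Levi action of the model preserves `𝒮(X)`**: translations, modulations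
by additive characters and the genuine Levi operators `ν(k) |k|^{1/2} f(k⁻¹ ·)`, in any order -/
theorem rep_translate_modulate_mem_schwartzBruhat (ν : Model L →* Circle) (k : Model L) (y : Space L)
    (χ : C(Space L, Circle)) (hχ : ∀ u v, χ (u + v) = χ u * χ v) {f : Lp ℂ 2 (μ L)}
    (hf : f ∈ schwartzBruhat L) :
    rep L ν k (translate (μ L) y (modulate (μ L) χ f)) ∈ schwartzBruhat L :=
  rep_mem_schwartzBruhat ν k (translate_mem_schwartzBruhat y (modulate_mem_schwartzBruhat χ hχ hf))

/-! ## §4  Density of `𝒮(X)` in `L²(X)` -/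

/-- proof-irrelevance of the set data of `indicatorConstLp` -/
theorem indicatorConstLp_congr_set {s t : Set (Space L)} (h : s = t) (hs : MeasurableSet s)
    (hμs : μ L s ≠ ∞) (ht : MeasurableSet t) (hμt : μ L t ≠ ∞) (c : ℂ) :
    indicatorConstLp 2 hs hμs c = indicatorConstLp 2 ht hμt c := by
  subst h; rfl

/-- the `L²`-distance between the indicator vectors of two sets of finite measure is controlled by
the measures of the two set differences -/
theorem norm_indicatorConstLp_sub_le {s t : Set (Space L)} (hs : MeasurableSet s) (hμs : μ L s ≠ ∞)
    (ht : MeasurableSet t) (hμt : μ L t ≠ ∞) (c : ℂ) :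
    ‖indicatorConstLp 2 hs hμs c - indicatorConstLp 2 ht hμt c‖ ≤
      ‖c‖ * (μ L).real (s \ t) ^ (1 / 2 : ℝ) + ‖c‖ * (μ L).real (t \ s) ^ (1 / 2 : ℝ) := by
  have hi : μ L (s ∩ t) ≠ ∞ := ne_top_of_le_ne_top hμs (measure_mono Set.inter_subset_left)
  have hd1 : μ L (s \ t) ≠ ∞ := ne_top_of_le_ne_top hμs (measure_mono Set.sdiff_subset)
  have hd2 : μ L (t \ s) ≠ ∞ := ne_top_of_le_ne_top hμt (measure_mono Set.sdiff_subset)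
  have h1 : indicatorConstLp 2 hs hμs c =
      indicatorConstLp 2 (hs.inter ht) hi c + indicatorConstLp 2 (hs.diff ht) hd1 c := by
    rw [← indicatorConstLp_disjoint_union (hs.inter ht) (hs.diff ht) hi hd1
      (disjoint_sdiff_right.mono_left Set.inter_subset_right) c]
    exact indicatorConstLp_congr_set (Set.inter_union_sdiff s t).symm _ _ _ _ _
  have h2 : indicatorConstLp 2 ht hμt c =
      indicatorConstLp 2 (hs.inter ht) hi c + indicatorConstLp 2 (ht.diff hs) hd2 c := by
    rw [← indicatorConstLp_disjoint_union (hs.inter ht) (ht.diff hs) hi hd2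
      (disjoint_sdiff_right.mono_left Set.inter_subset_left) c]
    exact indicatorConstLp_congr_set (by rw [Set.inter_comm]; exact (Set.inter_union_sdiff t s).symm)
      _ _ _ _ _
  rw [h1, h2, add_sub_add_left_eq_sub]
  refine (norm_sub_le _ _).trans (le_of_eq ?_)
  rw [norm_indicatorConstLp (by norm_num) (by norm_num), norm_indicatorConstLp (by norm_num) (by norm_num),
    ENNReal.toReal_ofNat]

/-- every indicator vector `c · 1_s` (`s` measurable of finite measure) is an `L²`-limit of vectors
of any subspace containing the indicator vectors of the compact open sets: inner and outer regularity
of the Haar measure `μ` squeeze `s` between a compact `K` and an open `U` of nearly the same measure,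
and §1 puts a compact open `C` between them -/
theorem indicatorConstLp_mem_topologicalClosure (S : Submodule ℂ (Lp ℂ 2 (μ L)))
    (hS : ∀ (A : Set (Space L)) (hA : IsCompact A) (hA' : IsOpen A) (c : ℂ), c • indCO L A hA hA' ∈ S)
    {s : Set (Space L)} (hs : MeasurableSet s) (hμs : μ L s ≠ ∞) (c : ℂ) :
    indicatorConstLp 2 hs hμs c ∈ S.topologicalClosure := by
  rw [← SetLike.mem_coe, Submodule.topologicalClosure_coe, Metric.mem_closure_iff]
  intro ε hε
  -- tolerance `t = (ε / (2(‖c‖+1)))²` on the measures of the set differences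
  have hc1 : 0 < ‖c‖ + 1 := by positivity
  set r : ℝ := ε / (2 * (‖c‖ + 1)) with hr_def
  have hr : 0 < r := by positivity
  set t : ℝ := r ^ 2 with ht_def
  have htpos : 0 < t := by positivity
  have hη : ENNReal.ofReal t ≠ 0 := (ENNReal.ofReal_pos.mpr htpos).ne'
  obtain ⟨K, hKs, hK, hμK⟩ := hs.exists_isCompact_sdiff_lt hμs hη
  obtain ⟨U, hUs, hU, -, hμUs⟩ := hs.exists_isOpen_sdiff_lt hμs hη
  obtain ⟨C, hC, hCo, hKC, hCU⟩ := exists_compactOpen_between hK hU (hKs.trans hUs)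
  refine ⟨indicatorConstLp 2 hCo.measurableSet hC.measure_lt_top.ne c, ?_, ?_⟩
  · rw [indicatorConstLp_eq_smul_indCO hC hCo]
    exact hS C hC hCo c
  rw [dist_eq_norm]
  refine (norm_indicatorConstLp_sub_le hs hμs hCo.measurableSet _ c).trans_lt ?_
  have h1 : (μ L).real (s \ C) < t :=
    ENNReal.toReal_lt_of_lt_ofReal ((measure_mono (Set.sdiff_subset_sdiff_right hKC)).trans_lt hμK)
  have h2 : (μ L).real (C \ s) < t :=
    ENNReal.toReal_lt_of_lt_ofReal ((measure_mono (Set.sdiff_subset_sdiff_left hCU)).trans_lt hμUs)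
  have hsq : t ^ (1 / 2 : ℝ) = r := by
    rw [ht_def, ← Real.sqrt_eq_rpow, Real.sqrt_sq hr.le]
  have hb : ∀ x : ℝ, 0 ≤ x → x < t → ‖c‖ * x ^ (1 / 2 : ℝ) ≤ ‖c‖ * r := fun x hx hxt => by
    rw [← hsq]
    exact mul_le_mul_of_nonneg_left (Real.rpow_le_rpow hx hxt.le (by norm_num)) (norm_nonneg c)
  have hlt : ‖c‖ * r + ‖c‖ * r < ε := by
    have h3 : ‖c‖ * r + ‖c‖ * r = ε * (‖c‖ / (‖c‖ + 1)) := by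
      rw [hr_def]; field_simp; ring
    have h4 : ‖c‖ / (‖c‖ + 1) < 1 := by rw [div_lt_one hc1]; exact lt_add_one _
    rw [h3]
    exact mul_lt_of_lt_one_right hε h4
  exact (add_le_add (hb _ measureReal_nonneg h1) (hb _ measureReal_nonneg h2)).trans_lt hlt

/-- **density criterion**: a subspace of `L²(X)` containing the indicator vectors of all compact
open sets is dense -/
theorem topologicalClosure_eq_top_of_indCO_mem (S : Submodule ℂ (Lp ℂ 2 (μ L)))
    (hS : ∀ (A : Set (Space L)) (hA : IsCompact A) (hA' : IsOpen A), indCO L A hA hA' ∈ S) :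
    S.topologicalClosure = ⊤ := by
  refine Submodule.eq_top_iff'.2 fun f => ?_
  refine Lp.induction (by norm_num : (2 : ℝ≥0∞) ≠ ∞) (fun f => f ∈ S.topologicalClosure) ?_ ?_ ?_ f
  · intro c s hs hμs
    rw [Lp.simpleFunc.coe_indicatorConst]
    exact indicatorConstLp_mem_topologicalClosure S
      (fun A hA hA' c => Submodule.smul_mem _ c (hS A hA hA')) hs hμs.ne c
  · intro f g _ _ _ hf' hg'
    exact add_mem hf' hg'
  · exact S.isClosed_topologicalClosure

/-- **the Schwartz–Bruhat space is dense in `L²(X)`** (MVW ch. 2, I.3; Weil 1964 no. 11) -/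
theorem topologicalClosure_schwartzBruhat : (schwartzBruhat L).topologicalClosure = ⊤ :=
  topologicalClosure_eq_top_of_indCO_mem _ fun A hA hA' => Submodule.subset_span ⟨⟨A, hA, hA'⟩, rfl⟩

/-- (Ported verbatim from the HodgeCMPerL package; no docstring in the source.) -/
theorem dense_schwartzBruhat : Dense (schwartzBruhat L : Set (Lp ℂ 2 (μ L))) :=
  Submodule.dense_iff_topologicalClosure_eq_top.2 topologicalClosure_schwartzBruhat

/-- hence a Schwartz–Bruhat-valued approximation of every `L²` vector: for every `f ∈ L²(X)` and
`ε > 0` there is a locally constant compactly supported `g` with `‖f - [g]‖ < ε` -/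
theorem exists_isSchwartzBruhat_norm_sub_lt (f : Lp ℂ 2 (μ L)) {ε : ℝ} (hε : 0 < ε) :
    ∃ (g : Space L → ℂ) (hg : IsSchwartzBruhat g), ‖f - hg.memLp.toLp g‖ < ε := by
  have hfc : f ∈ closure (schwartzBruhat L : Set (Lp ℂ 2 (μ L))) := by
    rw [dense_schwartzBruhat.closure_eq]; exact Set.mem_univ f
  obtain ⟨b, hb, hfb⟩ := Metric.mem_closure_iff.1 hfc ε hε
  obtain ⟨g, hg, hbg⟩ := mem_schwartzBruhat_iff.1 hb
  refine ⟨g, hg, ?_⟩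
  have hb' : b = hg.memLp.toLp g := Lp.ext (hbg.trans (MemLp.coeFn_toLp _).symm)
  rwa [← hb', ← dist_eq_norm]

/-- **operator extensionality on compact-open indicators**: two bounded operators on `L²(X)` that
agree on the indicator vectors `1_A` of the compact open sets are equal — so operator identities of
the model (e.g. the Heisenberg commutation relations asked of a candidate Weil representation in
`GenuineSchrodingerRigidEnd`) need only be checked on these vectors -/
theorem clm_eq_of_eqOn_indCO {A₁ A₂ : Lp ℂ 2 (μ L) →L[ℂ] Lp ℂ 2 (μ L)}
    (h : ∀ (A : Set (Space L)) (hA : IsCompact A) (hA' : IsOpen A),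
      A₁ (indCO L A hA hA') = A₂ (indCO L A hA hA')) : A₁ = A₂ := by
  refine ContinuousLinearMap.ext_on dense_schwartzBruhat ?_
  rintro _ ⟨⟨A, hA, hA'⟩, rfl⟩
  exact h A hA hA'

/-- in particular two bounded operators agreeing on `𝒮(X)` are equal -/
theorem clm_eq_of_eqOn_schwartzBruhat {A₁ A₂ : Lp ℂ 2 (μ L) →L[ℂ] Lp ℂ 2 (μ L)}
    (h : ∀ f ∈ schwartzBruhat L, A₁ f = A₂ f) : A₁ = A₂ :=
  clm_eq_of_eqOn_indCO fun A hA hA' => h _ (Submodule.subset_span ⟨⟨A, hA, hA'⟩, rfl⟩)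

/-- and a linear isometry of `L²(X)` is determined by its restriction to `𝒮(X)` -/
theorem linearIsometry_eq_of_eqOn_schwartzBruhat {A₁ A₂ : Lp ℂ 2 (μ L) →ₗᵢ[ℂ] Lp ℂ 2 (μ L)}
    (h : ∀ f ∈ schwartzBruhat L, A₁ f = A₂ f) : A₁ = A₂ := by
  have := clm_eq_of_eqOn_schwartzBruhat (A₁ := A₁.toContinuousLinearMap)
    (A₂ := A₂.toContinuousLinearMap) h
  exact LinearIsometry.toContinuousLinearMap_injective this

end Coeff

end HodgeCM.PerL34.PureTensor.SchrodingerModel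

-- port_pkg: scope closed for this part
end
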